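import Literature.Topology.FourManifolds.KnotsInBall
import Literature.Topology.FourManifolds.SpecialLinearPath
import Mathlib.Analysis.CStarAlgebra.Matrix
import Mathlib.Analysis.SpecialFunctions.ExpDeriv
import Mathlib.Analysis.SpecialFunctions.Pow.Real
import HarnessLib

/-!
# Affine maps of `ℝ³` with the same orientation are ambient isotopic on balls

Topic `Literature/Topology/FourManifolds`. A brick of the decomposition of the named fact
`Literature.Topology.FourManifolds.Knot.IsConnectedSum.isConcordant` (`BandSum.lean`; Fox–Milnor (1966), §1: concordance is a
congruence for `#`), on the branch "a tiny copy of the second factor carried along a concordance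
of the first factor": the tiny copy is read in two ball charts of `𝕊³` with the same orientation,
and the two readings are ambient isotopic (`BallChartIsotopy.lean`, to follow). The present file
proves the middle step of that chart-change isotopy, in `ℝ³` alone:

* `Literature.Topology.FourManifolds.AffineIsotopy.exists_ambientIsotopy_affine` — let `T₀ z = q₀ + L₀ (z - c)` and
  `T₁ z = q₁ + L₁ (z - c)` be affine automorphisms of `ℝ³` whose linear parts have determinants
  of the same sign. Then for every radius `r` there is an ambient isotopy `F` of `ℝ³`
  (`Literature.Topology.FourManifolds.AmbientIsotopy`), all of whose stages are the identity off one ball, with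
  `F 1 (T₀ z) = T₁ z` for `‖z - c‖ ≤ r`.

This is the elementary fact "`GL⁺(3, ℝ)` is connected" (Hirsch, *Differential Topology* (1976),
Ch. 8 §3, proof of Thm. 3.1, PDF p. 172 of the held copy: two embeddings of a disc with the same
orientation are joined through their linear parts, "since `GL⁺(n)` is connected"; and Ch. 8 §1,
Thm. 1.3 for realising the joining path by a compactly supported diffeotopy), made effective:

1. the path: `L_t = L₀ · d^{t/3} · γ(t)` where `d = det (L₀⁻¹ L₁) > 0` and `γ` is the tree's
   smooth path from `1` to the unimodular matrix `d^{-1/3} L₀⁻¹ L₁` in `SL(3, ℝ)`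
   (`Literature.Topology.FourManifolds.nonempty_smoothMatrixPath_of_det_eq_one`, `SpecialLinearPath.lean`, with its smooth
   inverse path), and `q_t = q₀ + t (q₁ - q₀)`;
2. the diffeotopy: the affine isotopy `A_t z = q_t + L_t (z - c)` consists of the integral
   curves of the globally smooth time-dependent field `Y(t, y) = q̇_t + L̇_t L_t⁻¹ (y - q_t)`, so
   the tree's cut-off-and-integrate lemma `Literature.Topology.FourManifolds.exists_ambientIsotopy_of_hasDerivAt`
   (`KnotsInBall.lean`, Hirsch's Thms. 1.2–1.4) provides a compactly supported ambient isotopy of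
   `ℝ³` following `A_t` on any ball.

Matrices act on `ℝ³ = EuclideanSpace ℝ (Fin 3)` through Mathlib's `Matrix.toEuclideanCLM`; the
inverse identification `Literature.Topology.FourManifolds.AffineIsotopy.toMat` is used to state the orientation hypothesis as
`0 < det L₀ · det L₁`.

## References

* M. W. Hirsch, *Differential Topology*, GTM 33, Springer (1976), Ch. 8 §1, Thms. 1.2–1.4; Ch. 8
  §3, Thm. 3.1 (proof). [HirschDT1976]
* R. H. Fox, J. W. Milnor, *Singularities of 2-spheres in 4-space and cobordism of knots*, Osaka
  J. Math. 3 (1966), 257–267, §1 (the consumer). [FoxMilnor1966]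
-/

open scoped Manifold ContDiff Topology Matrix
open Function Set Metric

noncomputable section

namespace Literature.Topology.FourManifolds

/-- Local notation: `𝔼 n` is the model Euclidean space `EuclideanSpace ℝ (Fin n)`. -/
local notation "𝔼 " n:arg => EuclideanSpace ℝ (Fin n)

namespace AffineIsotopy

/-! ### Matrices of operators on `ℝ³` -/

/-- The operator on `ℝ³ = EuclideanSpace ℝ (Fin 3)` of a real `3 × 3` matrix (Mathlib's
`Matrix.toEuclideanCLM`). [folklore] -/
abbrev toCLM (N : Matrix (Fin 3) (Fin 3) ℝ) : 𝔼 3 →L[ℝ] 𝔼 3 :=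
  Matrix.toEuclideanCLM (n := Fin 3) (𝕜 := ℝ) N

/-- The matrix of an operator on `ℝ³` (inverse of `Matrix.toEuclideanCLM`). [folklore] -/
abbrev toMat (A : 𝔼 3 →L[ℝ] 𝔼 3) : Matrix (Fin 3) (Fin 3) ℝ :=
  (Matrix.toEuclideanCLM (n := Fin 3) (𝕜 := ℝ)).symm A

/-- `toCLM` inverts `toMat`. [folklore] -/
@[simp]
theorem toCLM_toMat (A : 𝔼 3 →L[ℝ] 𝔼 3) : toCLM (toMat A) = A :=
  (Matrix.toEuclideanCLM (n := Fin 3) (𝕜 := ℝ)).apply_symm_apply A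

/-- `toMat` inverts `toCLM`. [folklore] -/
@[simp]
theorem toMat_toCLM (N : Matrix (Fin 3) (Fin 3) ℝ) : toMat (toCLM N) = N :=
  (Matrix.toEuclideanCLM (n := Fin 3) (𝕜 := ℝ)).symm_apply_apply N

/-- Components of the action of a matrix. [folklore] -/
theorem toCLM_apply (N : Matrix (Fin 3) (Fin 3) ℝ) (x : 𝔼 3) (i : Fin 3) :
    toCLM N x i = ∑ j, N i j * x j := by
  rw [show toCLM N x i = (WithLp.ofLp (toCLM N x)) i from rfl, Matrix.ofLp_toEuclideanCLM]
  rfl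

/-- `toCLM` is multiplicative: the operator of a product is the composite. [folklore] -/
theorem toCLM_mul (N N' : Matrix (Fin 3) (Fin 3) ℝ) : toCLM (N * N') = (toCLM N).comp (toCLM N') := by
  rw [toCLM, map_mul]
  rfl

/-- Applied form of `toCLM_mul`. [folklore] -/
theorem toCLM_mul_apply (N N' : Matrix (Fin 3) (Fin 3) ℝ) (x : 𝔼 3) :
    toCLM (N * N') x = toCLM N (toCLM N' x) := by
  rw [toCLM_mul]; rfl

/-- The identity matrix acts as the identity. [folklore] -/
@[simp]
theorem toCLM_one_apply (x : 𝔼 3) : toCLM 1 x = x := by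
  rw [toCLM, map_one]; rfl

/-- Scalar multiples of matrices act by scalar multiples. [folklore] -/
theorem toCLM_smul_apply (a : ℝ) (N : Matrix (Fin 3) (Fin 3) ℝ) (x : 𝔼 3) :
    toCLM (a • N) x = a • toCLM N x := by
  rw [toCLM, map_smul]; rfl

/-- `toMat` is multiplicative. [folklore] -/
theorem toMat_comp (A B : 𝔼 3 →L[ℝ] 𝔼 3) : toMat (A.comp B) = toMat A * toMat B := by
  have : A.comp B = A * B := rfl
  rw [this, toMat, map_mul]

/-- The matrix of the identity operator. [folklore] -/
@[simp]
theorem toMat_id : toMat (ContinuousLinearMap.id ℝ (𝔼 3)) = 1 := by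
  have : ContinuousLinearMap.id ℝ (𝔼 3) = 1 := rfl
  rw [this, toMat, map_one]

/-- For an automorphism `L`, `det L⁻¹ · det L = 1` (matrices via `toMat`). [folklore] -/
theorem det_toMat_symm_mul_det (L : 𝔼 3 ≃L[ℝ] 𝔼 3) :
    (toMat (L.symm : 𝔼 3 →L[ℝ] 𝔼 3)).det * (toMat (L : 𝔼 3 →L[ℝ] 𝔼 3)).det = 1 := by
  rw [← Matrix.det_mul, ← toMat_comp]
  have : (L.symm : 𝔼 3 →L[ℝ] 𝔼 3).comp (L : 𝔼 3 →L[ℝ] 𝔼 3) = ContinuousLinearMap.id ℝ (𝔼 3) := by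
    ext x : 1; simp
  rw [this, toMat_id, Matrix.det_one]

/-- The determinant of (the matrix of) an automorphism of `ℝ³` is nonzero. [folklore] -/
theorem det_toMat_ne_zero (L : 𝔼 3 ≃L[ℝ] 𝔼 3) : (toMat (L : 𝔼 3 →L[ℝ] 𝔼 3)).det ≠ 0 := by
  intro h
  have := det_toMat_symm_mul_det L
  rw [h, mul_zero] at this
  exact zero_ne_one this

/-! ### Smooth matrix paths as operator paths -/

/-- The elementary operators `E_{ij}` of `ℝ³` (operators of the matrix units). [folklore] -/
def elemCLM (i j : Fin 3) : 𝔼 3 →L[ℝ] 𝔼 3 := toCLM (Matrix.single i j 1)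

/-- Expansion of the operator of a matrix in the matrix units. [folklore] -/
theorem toCLM_eq_sum (N : Matrix (Fin 3) (Fin 3) ℝ) :
    toCLM N = ∑ i, ∑ j, N i j • elemCLM i j := by
  conv_lhs => rw [Matrix.matrix_eq_sum_single N]
  simp only [toCLM, map_sum, elemCLM]
  refine Finset.sum_congr rfl fun i _ ↦ Finset.sum_congr rfl fun j _ ↦ ?_
  rw [← map_smul, Matrix.smul_single, smul_eq_mul, mul_one]

/-- A matrix path with smooth entries gives a smooth operator path. [folklore] -/
theorem contDiff_toCLM_comp {n : WithTop ℕ∞} {N : ℝ → Matrix (Fin 3) (Fin 3) ℝ}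
    (h : ∀ i j, ContDiff ℝ n fun t ↦ N t i j) : ContDiff ℝ n fun t ↦ toCLM (N t) := by
  simp only [toCLM_eq_sum]
  exact ContDiff.sum fun i _ ↦ ContDiff.sum fun j _ ↦ (h i j).smul contDiff_const

/-- The entrywise derivative of a matrix path. [folklore] -/
def matDeriv (N : ℝ → Matrix (Fin 3) (Fin 3) ℝ) (t : ℝ) : Matrix (Fin 3) (Fin 3) ℝ :=
  Matrix.of fun i j ↦ deriv (fun τ ↦ N τ i j) t

/-- The operator path of a matrix path with differentiable entries has derivative the operator
of the entrywise derivative. [folklore] -/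
theorem hasDerivAt_toCLM_comp {N : ℝ → Matrix (Fin 3) (Fin 3) ℝ}
    (h : ∀ i j, Differentiable ℝ fun t ↦ N t i j) (t : ℝ) :
    HasDerivAt (fun τ ↦ toCLM (N τ)) (toCLM (matDeriv N t)) t := by
  have hij : ∀ i j, HasDerivAt (fun τ ↦ N τ i j • elemCLM i j) (matDeriv N t i j • elemCLM i j) t :=
    fun i j ↦ by
      simp only [matDeriv, Matrix.of_apply]
      exact (h i j t).hasDerivAt.smul_const (elemCLM i j)
  have key : HasDerivAt (fun τ ↦ ∑ i, ∑ j, N τ i j • elemCLM i j)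
      (∑ i, ∑ j, matDeriv N t i j • elemCLM i j) t :=
    HasDerivAt.sum (u := Finset.univ) (A := fun i τ ↦ ∑ j, N τ i j • elemCLM i j)
      (A' := fun i ↦ ∑ j, matDeriv N t i j • elemCLM i j) fun i _ ↦
      HasDerivAt.sum (u := Finset.univ) (A := fun j τ ↦ N τ i j • elemCLM i j)
        (A' := fun j ↦ matDeriv N t i j • elemCLM i j) fun j _ ↦ hij i j
  simpa only [toCLM_eq_sum] using key

/-- Entries of the entrywise derivative of a smooth path are smooth. [folklore] -/
theorem contDiff_matDeriv_apply {N : ℝ → Matrix (Fin 3) (Fin 3) ℝ}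
    (h : ∀ i j, ContDiff ℝ ∞ fun t ↦ N t i j) (i j : Fin 3) :
    ContDiff ℝ ∞ fun t ↦ matDeriv N t i j := by
  simp only [matDeriv, Matrix.of_apply]
  exact (h i j).deriv'

/-! ### The scaled unimodular path from `1` to a matrix of positive determinant -/

section Path

variable (M : Matrix (Fin 3) (Fin 3) ℝ) (hM : 0 < M.det)

/-- The unimodular normalisation `det(M)^{-1/3} M` of a matrix of positive determinant. [folklore] -/
def unimod : Matrix (Fin 3) (Fin 3) ℝ := (M.det ^ (-(1 / 3) : ℝ)) • M

include hM in
/-- `det (det(M)^{-1/3} M) = 1`. [folklore] -/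
theorem det_unimod : (unimod M).det = 1 := by
  rw [unimod, Matrix.det_smul, Fintype.card_fin]
  rw [← Real.rpow_natCast, ← Real.rpow_mul hM.le]
  norm_num
  rw [Real.rpow_neg_one, inv_mul_cancel₀ hM.ne']

/-- A smooth path from `1` to `unimod M` in `SL(3, ℝ)` (`SpecialLinearPath.lean`). [folklore] -/
def slPath : SmoothMatrixPath (unimod M) :=
  Classical.choice (nonempty_smoothMatrixPath_of_det_eq_one _ (det_unimod M hM))

/-- The scalar factor `d^{t/3} = exp (t log d / 3)`, `d = det M`. [folklore] -/
def scale (t : ℝ) : ℝ := Real.exp (t * (Real.log M.det / 3))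

/-- The scalar factor is smooth. [folklore] -/
theorem contDiff_scale : ContDiff ℝ ∞ (scale M) :=
  Real.contDiff_exp.comp (contDiff_id.mul contDiff_const)

/-- The scalar factor is positive. [folklore] -/
theorem scale_pos (t : ℝ) : 0 < scale M t := Real.exp_pos _

/-- `scale M 0 = 1`. [folklore] -/
@[simp]
theorem scale_zero : scale M 0 = 1 := by simp [scale]

include hM in
/-- `scale M 1 = det(M)^{1/3}`. [folklore] -/
theorem scale_one : scale M 1 = M.det ^ ((1 / 3 : ℝ)) := by
  rw [scale, one_mul, Real.rpow_def_of_pos hM]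
  congr 1
  ring

/-- **The path** `N_t = d^{t/3} γ(t)` from `1` to `M` through invertible matrices. [folklore] -/
def path (t : ℝ) : Matrix (Fin 3) (Fin 3) ℝ := scale M t • (slPath M hM).toFun t

/-- The inverse path `N_t⁻¹ = d^{-t/3} γ(t)⁻¹`. [folklore] -/
def pathInv (t : ℝ) : Matrix (Fin 3) (Fin 3) ℝ := (scale M t)⁻¹ • (slPath M hM).inv t

/-- `N_t⁻¹ N_t = 1`. [folklore] -/
theorem pathInv_mul_path (t : ℝ) : pathInv M hM t * path M hM t = 1 := by
  rw [pathInv, path, Matrix.smul_mul, Matrix.mul_smul, (slPath M hM).inv_mul, smul_smul,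
    inv_mul_cancel₀ (scale_pos M t).ne', one_smul]

/-- `N_t N_t⁻¹ = 1`. [folklore] -/
theorem path_mul_pathInv (t : ℝ) : path M hM t * pathInv M hM t = 1 := by
  rw [pathInv, path, Matrix.smul_mul, Matrix.mul_smul, (slPath M hM).mul_inv, smul_smul,
    mul_inv_cancel₀ (scale_pos M t).ne', one_smul]

/-- The path starts at `1`. [folklore] -/
theorem path_zero : path M hM 0 = 1 := by
  rw [path, scale_zero, one_smul, (slPath M hM).eq_one 0 le_rfl]

/-- The path ends at `M`. [folklore] -/
theorem path_one : path M hM 1 = M := by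
  rw [path, scale_one M hM, (slPath M hM).eq_self 1 le_rfl, unimod, smul_smul,
    ← Real.rpow_add hM]
  norm_num

/-- The entries of the path are smooth. [folklore] -/
theorem contDiff_path_apply (i j : Fin 3) : ContDiff ℝ ∞ fun t ↦ path M hM t i j := by
  simp only [path, Matrix.smul_apply, smul_eq_mul]
  exact (contDiff_scale M).mul ((slPath M hM).contDiff_apply i j)

/-- The entries of the inverse path are smooth. [folklore] -/
theorem contDiff_pathInv_apply (i j : Fin 3) : ContDiff ℝ ∞ fun t ↦ pathInv M hM t i j := by
  simp only [pathInv, Matrix.smul_apply, smul_eq_mul]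
  exact ((contDiff_scale M).inv fun t ↦ (scale_pos M t).ne').mul
    ((slPath M hM).contDiff_inv_apply i j)

/-- The operator of `N_t⁻¹` inverts the operator of `N_t`. [folklore] -/
theorem toCLM_pathInv_apply (t : ℝ) (x : 𝔼 3) :
    toCLM (pathInv M hM t) (toCLM (path M hM t) x) = x := by
  rw [← toCLM_mul_apply, pathInv_mul_path, toCLM_one_apply]

end Path

/-! ### The affine isotopy -/

section Affine

variable (q₀ q₁ c : 𝔼 3) (L₀ L₁ : 𝔼 3 ≃L[ℝ] 𝔼 3)

/-- The transition matrix `L₀⁻¹ L₁` of two automorphisms of `ℝ³`. [folklore] -/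
def transition : Matrix (Fin 3) (Fin 3) ℝ :=
  toMat ((L₀.symm : 𝔼 3 →L[ℝ] 𝔼 3).comp (L₁ : 𝔼 3 →L[ℝ] 𝔼 3))

/-- `L₀ (L₀⁻¹ L₁) x = L₁ x`. [folklore] -/
theorem apply_toCLM_transition (x : 𝔼 3) : L₀ (toCLM (transition L₀ L₁) x) = L₁ x := by
  rw [transition, toCLM_toMat]
  simp

variable {L₀ L₁} in
/-- Automorphisms with determinants of the same sign have a transition matrix of positive
determinant. [folklore] -/
theorem det_transition_pos
    (h : 0 < (toMat (L₀ : 𝔼 3 →L[ℝ] 𝔼 3)).det * (toMat (L₁ : 𝔼 3 →L[ℝ] 𝔼 3)).det) :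
    0 < (transition L₀ L₁).det := by
  rw [transition, toMat_comp, Matrix.det_mul]
  have h1 := det_toMat_symm_mul_det L₀
  have h0 : (toMat (L₀ : 𝔼 3 →L[ℝ] 𝔼 3)).det ≠ 0 := det_toMat_ne_zero L₀
  have hs : (toMat (L₀.symm : 𝔼 3 →L[ℝ] 𝔼 3)).det = ((toMat (L₀ : 𝔼 3 →L[ℝ] 𝔼 3)).det)⁻¹ :=
    eq_inv_of_mul_eq_one_left h1
  rw [hs]
  have : ((toMat (L₀ : 𝔼 3 →L[ℝ] 𝔼 3)).det)⁻¹ * (toMat (L₁ : 𝔼 3 →L[ℝ] 𝔼 3)).det =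
      ((toMat (L₀ : 𝔼 3 →L[ℝ] 𝔼 3)).det * (toMat (L₁ : 𝔼 3 →L[ℝ] 𝔼 3)).det) /
        (toMat (L₀ : 𝔼 3 →L[ℝ] 𝔼 3)).det ^ 2 := by
    field_simp
  rw [this]
  positivity

variable (hdet : 0 < (transition L₀ L₁).det)

/-- The affine isotopy `A_t z = q₀ + t (q₁ - q₀) + L₀ N_t (z - c)` from `T₀` to `T₁`. [folklore] -/
def affinePath (t : ℝ) (z : 𝔼 3) : 𝔼 3 :=
  q₀ + t • (q₁ - q₀) + L₀ (toCLM (path (transition L₀ L₁) hdet t) (z - c))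

/-- At time `0` the affine isotopy is `T₀ z = q₀ + L₀ (z - c)`. [folklore] -/
theorem affinePath_zero (z : 𝔼 3) : affinePath q₀ q₁ c L₀ L₁ hdet 0 z = q₀ + L₀ (z - c) := by
  simp [affinePath, path_zero]

/-- At time `1` the affine isotopy is `T₁ z = q₁ + L₁ (z - c)`. [folklore] -/
theorem affinePath_one (z : 𝔼 3) : affinePath q₀ q₁ c L₀ L₁ hdet 1 z = q₁ + L₁ (z - c) := by
  simp [affinePath, path_one, apply_toCLM_transition]

/-- The generating time-dependent field `Y(t, y) = (q₁ - q₀) + L₀ Ṅ_t N_t⁻¹ L₀⁻¹ (y - q_t)` of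
the affine isotopy. [folklore] -/
def field (p : ℝ × 𝔼 3) : 𝔼 3 :=
  (q₁ - q₀) + L₀ (toCLM (matDeriv (path (transition L₀ L₁) hdet) p.1)
    (toCLM (pathInv (transition L₀ L₁) hdet p.1) (L₀.symm (p.2 - (q₀ + p.1 • (q₁ - q₀))))))

/-- The generating field is smooth. [folklore] -/
theorem contDiff_field : ContDiff ℝ ∞ (field q₀ q₁ L₀ L₁ hdet) := by
  unfold field
  have h1 : ContDiff ℝ ∞ fun p : ℝ × 𝔼 3 ↦ toCLM (matDeriv (path (transition L₀ L₁) hdet) p.1) :=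
    (contDiff_toCLM_comp (contDiff_matDeriv_apply (contDiff_path_apply _ hdet))).comp contDiff_fst
  have h2 : ContDiff ℝ ∞ fun p : ℝ × 𝔼 3 ↦ toCLM (pathInv (transition L₀ L₁) hdet p.1) :=
    (contDiff_toCLM_comp (contDiff_pathInv_apply _ hdet)).comp contDiff_fst
  have h3 : ContDiff ℝ ∞ fun p : ℝ × 𝔼 3 ↦ L₀.symm (p.2 - (q₀ + p.1 • (q₁ - q₀))) :=
    (L₀.symm : 𝔼 3 →L[ℝ] 𝔼 3).contDiff.comp
      (contDiff_snd.sub (contDiff_const.add (contDiff_fst.smul contDiff_const)))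
  exact contDiff_const.add ((L₀ : 𝔼 3 →L[ℝ] 𝔼 3).contDiff.comp (h1.clm_apply (h2.clm_apply h3)))

/-- The curves of the affine isotopy solve the ODE of the generating field. [folklore] -/
theorem hasDerivAt_affinePath (z : 𝔼 3) (t : ℝ) :
    HasDerivAt (fun τ ↦ affinePath q₀ q₁ c L₀ L₁ hdet τ z)
      (field q₀ q₁ L₀ L₁ hdet (t, affinePath q₀ q₁ c L₀ L₁ hdet t z)) t := by
  set N := path (transition L₀ L₁) hdet with hN
  have hdiff : ∀ i j, Differentiable ℝ fun τ ↦ N τ i j := fun i j ↦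
    (contDiff_path_apply (transition L₀ L₁) hdet i j).differentiable (by simp)
  -- derivative of `τ ↦ toCLM (N τ) (z - c)`
  have hA : HasDerivAt (fun τ ↦ toCLM (N τ) (z - c)) (toCLM (matDeriv N t) (z - c)) t := by
    have h := (hasDerivAt_toCLM_comp hdiff t).clm_apply (hasDerivAt_const t (z - c))
    simpa using h
  have hB : HasDerivAt (fun τ ↦ L₀ (toCLM (N τ) (z - c))) (L₀ (toCLM (matDeriv N t) (z - c))) t :=
    (L₀ : 𝔼 3 →L[ℝ] 𝔼 3).hasFDerivAt.comp_hasDerivAt t hA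
  have hC : HasDerivAt (fun τ : ℝ ↦ q₀ + τ • (q₁ - q₀)) (q₁ - q₀) t := by
    simpa using ((hasDerivAt_id t).smul_const (q₁ - q₀)).const_add q₀
  have hD := hC.add hB
  have heq : field q₀ q₁ L₀ L₁ hdet (t, affinePath q₀ q₁ c L₀ L₁ hdet t z) =
      (q₁ - q₀) + L₀ (toCLM (matDeriv N t) (z - c)) := by
    simp only [field, affinePath, ← hN]
    congr 2
    rw [show q₀ + t • (q₁ - q₀) + L₀ ((toCLM (N t)) (z - c)) - (q₀ + t • (q₁ - q₀)) =
      L₀ ((toCLM (N t)) (z - c)) by abel, ContinuousLinearEquiv.symm_apply_apply,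
      toCLM_pathInv_apply]
  rw [heq]
  exact hD

/-- The affine isotopy is jointly continuous. [folklore] -/
theorem continuous_affinePath :
    Continuous fun p : ℝ × 𝔼 3 ↦ affinePath q₀ q₁ c L₀ L₁ hdet p.1 p.2 := by
  unfold affinePath
  have h1 : Continuous fun p : ℝ × 𝔼 3 ↦ toCLM (path (transition L₀ L₁) hdet p.1) :=
    ((contDiff_toCLM_comp (contDiff_path_apply _ hdet)).continuous).comp continuous_fst
  exact (continuous_const.add (continuous_fst.smul continuous_const)).add
    ((L₀ : 𝔼 3 →L[ℝ] 𝔼 3).continuous.comp (h1.clm_apply (continuous_snd.sub continuous_const)))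

/-- **Affine maps of `ℝ³` with the same orientation are ambient isotopic on balls.** Let
`T₀ z = q₀ + L₀ (z - c)`, `T₁ z = q₁ + L₁ (z - c)` with `det L₀ · det L₁ > 0`. For every `r`
there is an ambient isotopy `F` of `ℝ³`, equal to the identity off one ball at all times, with
`F 1 (T₀ z) = T₁ z` whenever `‖z - c‖ ≤ r` (Hirsch (1976), Ch. 8 §3, proof of Thm. 3.1: join the
linear parts in the connected group `GL⁺`; Ch. 8 §1, Thms. 1.2–1.4: realise the path by the flow
of a cut-off time-dependent vector field). [cite: HirschDT1976, Ch. 8 §3, Thm. 3.1 (proof)] -/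
theorem exists_ambientIsotopy_affine
    (h : 0 < (toMat (L₀ : 𝔼 3 →L[ℝ] 𝔼 3)).det * (toMat (L₁ : 𝔼 3 →L[ℝ] 𝔼 3)).det) (r : ℝ) :
    ∃ F : AmbientIsotopy 𝓘(ℝ, 𝔼 3) (𝔼 3),
      (∀ z ∈ closedBall c r, F.toFun 1 (q₀ + L₀ (z - c)) = q₁ + L₁ (z - c)) ∧
      ∃ R : ℝ, ∀ t (y : 𝔼 3), R ≤ ‖y‖ → F.toFun t y = y := by
  have hdet : 0 < (transition L₀ L₁).det := det_transition_pos h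
  set A := affinePath q₀ q₁ c L₀ L₁ hdet with hA
  -- the compact set swept out by the ball during times `[-1, 2]`
  set K : Set (𝔼 3) := (fun p : ℝ × 𝔼 3 ↦ A p.1 p.2) '' (Icc (-1 : ℝ) 2 ×ˢ closedBall c r) with hK
  have hKc : IsCompact K :=
    (isCompact_Icc.prod (isCompact_closedBall c r)).image (continuous_affinePath q₀ q₁ c L₀ L₁ hdet)
  obtain ⟨G, ⟨C, hC, -, hGC⟩, hG⟩ := exists_ambientIsotopy_of_hasDerivAt
    (contDiff_field q₀ q₁ L₀ L₁ hdet) (ι := closedBall c r) (c := fun z t ↦ A t z)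
    (fun z t _ ↦ hasDerivAt_affinePath q₀ q₁ c L₀ L₁ hdet z t) hKc isOpen_univ (subset_univ _)
    (fun z t ht ↦ ⟨(t, (z : 𝔼 3)), ⟨⟨ht.1.le, ht.2.le⟩, z.2⟩, rfl⟩)
  refine ⟨G, fun z hz ↦ ?_, ?_⟩
  · have h1 := hG ⟨z, hz⟩ 1 (right_mem_Icc.2 zero_le_one)
    simp only [hA, affinePath_zero, affinePath_one] at h1
    exact h1
  · obtain ⟨R₀, hR₀⟩ := hC.isBounded.subset_closedBall 0
    refine ⟨R₀ + 1, fun t y hy ↦ hGC t y fun hyC ↦ ?_⟩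
    have := hR₀ hyC
    rw [mem_closedBall, dist_zero_right] at this
    linarith

end Affine

end AffineIsotopy

end Literature.Topology.FourManifolds
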